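import Summits.Ventures.PercRepro.C041TwoExitZone

/-!
# ROW C-041 — THE MULTI-EXIT ATTACHMENT: an unmarked multigraph with a FAMILY of zones hung at a family of its
vertices, and its reaches (p6, gen 33; mine-3's C-041.md §20 (c) BLOCK MAPS with `r` exits — the general form of
`glue2` … `glue5` of `C041TwoExitZone` … `C041FiveExitZone`)

`hang Z₁ u Z a` hangs, for every index `k : ι`, the zone `Z k` (anchor `a k`) at the exit `u k` of the UNMARKED
multigraph `Z₁`: the vertices are `V₁ ⊕ Σ k, V k`, every incidence of the anchor `a k` is REDIRECTED to the
junction `inl (u k)` (`red`), and `inr ⟨k, a k⟩` is a stray isolated unmarked vertex — no quotient, no iterated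
sum.  A state of the attachment is a colouring of `Z₁` (`col₁`) with a state of every zone (`st σ k`).  EVERY REACH
is read off the host and the zones (`inl_mem_reach_iff`, `inr_mem_reach_iff`, for any colour and any source set
avoiding the stray vertices): the HOST SOURCES of a set `S` are its host part together with the exits whose zone
reaches its anchor from the zone part of `S` (`hostSrc`); a host vertex is reached iff it is reached inside `Z₁`
from the host sources; a zone vertex iff it is not the stray vertex and is reached inside its zone from the zone
part of `S`, or its junction is reached and it is connected to the anchor inside its zone.  The marks of the
attachment are the marks of the zones at their redirected positions (`inl_mem_markSet_hang`,
`inr_mem_markSet_hang`, `stray_not_mem_markSet_hang`).  The zone sets at the anchor are the next module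
(`C041MultiExitSets`).
-/

namespace PercRepro

namespace ZoneZ

namespace MultiExit

open ZoneData Pendant

variable {ι V₁ E₁ U₁ U₂ : Type} {V E T₁ T₂ : ι → Type}
variable (Z₁ : ZoneData V₁ E₁ U₁ U₂) (u : ι → V₁) (Z : (k : ι) → ZoneData (V k) (E k) (T₁ k) (T₂ k))
  (a : (k : ι) → V k)

/-! ## The redirection and the attachment -/

open Classical in
/-- The redirection of the vertices of the zone `Z k`: the anchor `a k` becomes the junction `inl (u k)`, every
other vertex stays as `inr ⟨k, x⟩`. -/
noncomputable def red (k : ι) (x : V k) : V₁ ⊕ (Σ k, V k) :=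
  if x = a k then Sum.inl (u k) else Sum.inr ⟨k, x⟩

/-- The anchor of a zone is redirected to its junction. -/
theorem red_self (k : ι) : red u a k (a k) = Sum.inl (u k) := by
  unfold red
  rw [if_pos rfl]

/-- Another vertex of a zone stays. -/
theorem red_of_ne {k : ι} {x : V k} (h : x ≠ a k) : red u a k x = Sum.inr ⟨k, x⟩ := by
  unfold red
  rw [if_neg h]

/-- A redirected vertex is a host vertex only as the junction. -/
theorem eq_of_red_eq_inl {k : ι} {x : V k} {v : V₁} (h : red u a k x = Sum.inl v) : x = a k ∧ v = u k := by
  by_cases hx : x = a k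
  · rw [hx, red_self] at h
    exact ⟨hx, (Sum.inl.inj h).symm⟩
  · rw [red_of_ne u a hx] at h
    exact absurd h (by simp)

/-- A redirected vertex is a zone vertex only if it is not the anchor, and then of the same zone. -/
theorem eq_of_red_eq_inr {k l : ι} {x : V k} {y : V l} (h : red u a k x = Sum.inr ⟨l, y⟩) :
    x ≠ a k ∧ (⟨k, x⟩ : Σ k, V k) = ⟨l, y⟩ := by
  by_cases hx : x = a k
  · rw [hx, red_self] at h
    exact absurd h (by simp)
  · rw [red_of_ne u a hx] at h
    exact ⟨hx, Sum.inr.inj h⟩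

/-- THE MULTI-EXIT ATTACHMENT: the unmarked multigraph `Z₁` with the zone `Z k` hung at the exit `u k` for every
`k` (its anchor `a k` identified with `u k`; the marks of `Z₁` are dropped, the marks of the zones redirected). -/
noncomputable def hang : ZoneData (V₁ ⊕ (Σ k, V k)) (E₁ ⊕ (Σ k, E k)) (Σ k, T₁ k) (Σ k, T₂ k) where
  fst := Sum.elim (fun e => Sum.inl (Z₁.fst e)) (fun e => red u a e.1 ((Z e.1).fst e.2))
  snd := Sum.elim (fun e => Sum.inl (Z₁.snd e)) (fun e => red u a e.1 ((Z e.1).snd e.2))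
  at₁ := fun t => red u a t.1 ((Z t.1).at₁ t.2)
  at₂ := fun t => red u a t.1 ((Z t.1).at₂ t.2)

/-- The colouring of `Z₁` in a state of the attachment. -/
def col₁ (σ : State (E₁ ⊕ (Σ k, E k)) (Σ k, T₁ k) (Σ k, T₂ k)) : E₁ → Bool := fun e => σ.1 (Sum.inl e)

/-- The state of the zone `Z k` in a state of the attachment. -/
def st (σ : State (E₁ ⊕ (Σ k, E k)) (Σ k, T₁ k) (Σ k, T₂ k)) (k : ι) : State (E k) (T₁ k) (T₂ k) :=
  (fun e => σ.1 (Sum.inr ⟨k, e⟩), fun t => σ.2.1 ⟨k, t⟩, fun t => σ.2.2 ⟨k, t⟩)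

variable (c : Bool) (σ : State (E₁ ⊕ (Σ k, E k)) (Σ k, T₁ k) (Σ k, T₂ k))

/-! ## Lifting adjacencies and paths -/

/-- An adjacency of `Z₁` lifts to the attachment. -/
theorem adj_of_left {v v' : V₁} (h : cAdj Z₁ c (col₁ σ) v v') :
    cAdj (hang Z₁ u Z a) c σ.1 (Sum.inl v) (Sum.inl v') := by
  obtain ⟨e, he, hc⟩ := h
  refine ⟨Sum.inl e, ?_, hc⟩
  rcases he with ⟨rfl, rfl⟩ | ⟨rfl, rfl⟩
  · exact Or.inl ⟨rfl, rfl⟩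
  · exact Or.inr ⟨rfl, rfl⟩

/-- An adjacency of a zone lifts to the attachment (through the redirection). -/
theorem adj_of_right (k : ι) {x y : V k} (h : cAdj (Z k) c (st σ k).1 x y) :
    cAdj (hang Z₁ u Z a) c σ.1 (red u a k x) (red u a k y) := by
  obtain ⟨e, he, hc⟩ := h
  refine ⟨Sum.inr ⟨k, e⟩, ?_, hc⟩
  rcases he with ⟨rfl, rfl⟩ | ⟨rfl, rfl⟩
  · exact Or.inl ⟨rfl, rfl⟩
  · exact Or.inr ⟨rfl, rfl⟩

/-- A path of `Z₁` lifts. -/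
theorem reflTransGen_of_left {v v' : V₁} (h : Relation.ReflTransGen (cAdj Z₁ c (col₁ σ)) v v') :
    Relation.ReflTransGen (cAdj (hang Z₁ u Z a) c σ.1) (Sum.inl v) (Sum.inl v') := by
  induction h with
  | refl => exact Relation.ReflTransGen.refl
  | tail _ h ih => exact ih.tail (adj_of_left Z₁ u Z a c σ h)

/-- A path of a zone lifts. -/
theorem reflTransGen_of_right (k : ι) {x y : V k} (h : Relation.ReflTransGen (cAdj (Z k) c (st σ k).1) x y) :
    Relation.ReflTransGen (cAdj (hang Z₁ u Z a) c σ.1) (red u a k x) (red u a k y) := by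
  induction h with
  | refl => exact Relation.ReflTransGen.refl
  | tail _ h ih => exact ih.tail (adj_of_right Z₁ u Z a c σ k h)

/-! ## The reach of the attachment, read off the host and the zones -/

/-- The host part of a vertex set of the attachment. -/
def leftSet (S : Set (V₁ ⊕ (Σ k, V k))) : Set V₁ := {v | Sum.inl v ∈ S}

/-- The part of a vertex set of the attachment in the zone `Z k`. -/
def rightSet (S : Set (V₁ ⊕ (Σ k, V k))) (k : ι) : Set (V k) := {x | Sum.inr ⟨k, x⟩ ∈ S}

/-- THE HOST SOURCES of `S`: its host part, and every exit whose zone reaches its anchor from the zone part of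
`S`. -/
def hostSrc (S : Set (V₁ ⊕ (Σ k, V k))) : Set V₁ :=
  leftSet S ∪ {v | ∃ k, v = u k ∧ a k ∈ reach (cAdj (Z k) c (st σ k).1) (rightSet S k)}

/-- The candidate reach condition, vertex by vertex. -/
def reachCond (S : Set (V₁ ⊕ (Σ k, V k))) : V₁ ⊕ (Σ k, V k) → Prop
  | Sum.inl v => v ∈ reach (cAdj Z₁ c (col₁ σ)) (hostSrc u Z a c σ S)
  | Sum.inr ⟨k, x⟩ => x ≠ a k ∧ (x ∈ reach (cAdj (Z k) c (st σ k).1) (rightSet S k) ∨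
      (u k ∈ reach (cAdj Z₁ c (col₁ σ)) (hostSrc u Z a c σ S) ∧ x ∈ reach (cAdj (Z k) c (st σ k).1) {a k}))

/-- The reach condition at a redirected vertex of a zone. -/
theorem reachCond_red_iff (S : Set (V₁ ⊕ (Σ k, V k))) (k : ι) (x : V k) :
    reachCond Z₁ u Z a c σ S (red u a k x) ↔
      x ∈ reach (cAdj (Z k) c (st σ k).1) (rightSet S k) ∨
        (u k ∈ reach (cAdj Z₁ c (col₁ σ)) (hostSrc u Z a c σ S) ∧ x ∈ reach (cAdj (Z k) c (st σ k).1) {a k}) := by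
  by_cases hx : x = a k
  · subst hx
    rw [red_self]
    simp only [reachCond]
    constructor
    · intro h
      exact Or.inr ⟨h, mem_reach_of_mem rfl⟩
    · rintro (h | ⟨h, -⟩)
      · exact mem_reach_of_mem (Or.inr ⟨k, rfl, h⟩)
      · exact h
  · rw [red_of_ne u a hx]
    simp only [reachCond, ne_eq, hx, not_false_eq_true, true_and]

/-- The reach condition is closed under the lifted adjacencies of a zone. -/
theorem reachCond_tail_right (S : Set (V₁ ⊕ (Σ k, V k))) (k : ι) {x y : V k}
    (hx : reachCond Z₁ u Z a c σ S (red u a k x)) (h : cAdj (Z k) c (st σ k).1 x y) :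
    reachCond Z₁ u Z a c σ S (red u a k y) := by
  rw [reachCond_red_iff] at hx ⊢
  rcases hx with hx | ⟨hj, hx⟩
  · exact Or.inl (reach_tail hx h)
  · exact Or.inr ⟨hj, reach_tail hx h⟩

/-- The reach condition is closed under the lifted adjacencies of `Z₁`. -/
theorem reachCond_tail_left (S : Set (V₁ ⊕ (Σ k, V k))) {v v' : V₁}
    (hv : reachCond Z₁ u Z a c σ S (Sum.inl v)) (h : cAdj Z₁ c (col₁ σ) v v') :
    reachCond Z₁ u Z a c σ S (Sum.inl v') := by
  simp only [reachCond] at hv ⊢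
  exact reach_tail hv h

/-- The reach condition holds on the reach (for a source set avoiding the stray vertices). -/
theorem reachCond_of_mem_reach (S : Set (V₁ ⊕ (Σ k, V k))) (hS : ∀ k, Sum.inr ⟨k, a k⟩ ∉ S)
    {w : V₁ ⊕ (Σ k, V k)} (hw : w ∈ reach (cAdj (hang Z₁ u Z a) c σ.1) S) : reachCond Z₁ u Z a c σ S w := by
  refine reach_subset_of_closed (U := {w | reachCond Z₁ u Z a c σ S w}) ?_ ?_ hw
  · intro w hwS
    rcases w with v | ⟨k, x⟩
    · exact mem_reach_of_mem (Or.inl hwS)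
    · refine ⟨fun hx => hS k (hx ▸ hwS), Or.inl (mem_reach_of_mem hwS)⟩
  · rintro w w' hw ⟨e, he, hc⟩
    rcases e with e | ⟨k, e⟩
    · simp only [Joins, hang, Sum.elim_inl] at he
      rcases he with ⟨rfl, rfl⟩ | ⟨rfl, rfl⟩
      · exact reachCond_tail_left Z₁ u Z a c σ S hw ⟨e, Or.inl ⟨rfl, rfl⟩, hc⟩
      · exact reachCond_tail_left Z₁ u Z a c σ S hw ⟨e, Or.inr ⟨rfl, rfl⟩, hc⟩
    · simp only [Joins, hang, Sum.elim_inr] at he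
      rcases he with ⟨rfl, rfl⟩ | ⟨rfl, rfl⟩
      · exact reachCond_tail_right Z₁ u Z a c σ S k hw ⟨e, Or.inl ⟨rfl, rfl⟩, hc⟩
      · exact reachCond_tail_right Z₁ u Z a c σ S k hw ⟨e, Or.inr ⟨rfl, rfl⟩, hc⟩

/-- A vertex of a zone reached inside the zone from the zone part of `S` is reached in the attachment. -/
theorem red_mem_reach_of_right (S : Set (V₁ ⊕ (Σ k, V k))) (hS : ∀ k, Sum.inr ⟨k, a k⟩ ∉ S) (k : ι) {x : V k}
    (h : x ∈ reach (cAdj (Z k) c (st σ k).1) (rightSet S k)) :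
    red u a k x ∈ reach (cAdj (hang Z₁ u Z a) c σ.1) S := by
  obtain ⟨s, hs, hsx⟩ := h
  have hsa : s ≠ a k := fun h => hS k (h ▸ hs)
  refine ⟨red u a k s, ?_, reflTransGen_of_right Z₁ u Z a c σ k hsx⟩
  rw [red_of_ne u a hsa]
  exact hs

/-- A host vertex reached inside `Z₁` from the host sources is reached in the attachment. -/
theorem inl_mem_reach_of_hostSrc (S : Set (V₁ ⊕ (Σ k, V k))) (hS : ∀ k, Sum.inr ⟨k, a k⟩ ∉ S) {v : V₁}
    (h : v ∈ reach (cAdj Z₁ c (col₁ σ)) (hostSrc u Z a c σ S)) :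
    Sum.inl v ∈ reach (cAdj (hang Z₁ u Z a) c σ.1) S := by
  obtain ⟨s, hs, hsv⟩ := h
  have hpath := reflTransGen_of_left Z₁ u Z a c σ hsv
  rcases hs with hs | ⟨k, rfl, hk⟩
  · exact ⟨Sum.inl s, hs, hpath⟩
  · have h1 := red_mem_reach_of_right Z₁ u Z a c σ S hS k hk
    rw [red_self] at h1
    exact reach_trans h1 hpath

/-- The reach condition puts the vertex in the reach. -/
theorem mem_reach_of_reachCond (S : Set (V₁ ⊕ (Σ k, V k))) (hS : ∀ k, Sum.inr ⟨k, a k⟩ ∉ S)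
    {w : V₁ ⊕ (Σ k, V k)} (hw : reachCond Z₁ u Z a c σ S w) : w ∈ reach (cAdj (hang Z₁ u Z a) c σ.1) S := by
  rcases w with v | ⟨k, x⟩
  · exact inl_mem_reach_of_hostSrc Z₁ u Z a c σ S hS hw
  · obtain ⟨hx, hw⟩ := hw
    rcases hw with hw | ⟨hj, hw⟩
    · have := red_mem_reach_of_right Z₁ u Z a c σ S hS k hw
      rwa [red_of_ne u a hx] at this
    · obtain ⟨s, hs, hsx⟩ := hw
      rw [Set.mem_singleton_iff] at hs
      rw [hs] at hsx
      have h2 := reflTransGen_of_right Z₁ u Z a c σ k hsx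
      rw [red_self, red_of_ne u a hx] at h2
      exact reach_trans (inl_mem_reach_of_hostSrc Z₁ u Z a c σ S hS hj) h2

/-- **A host vertex is reached** iff it is reached inside `Z₁` from the host sources of `S`. -/
theorem inl_mem_reach_iff (S : Set (V₁ ⊕ (Σ k, V k))) (hS : ∀ k, Sum.inr ⟨k, a k⟩ ∉ S) (v : V₁) :
    Sum.inl v ∈ reach (cAdj (hang Z₁ u Z a) c σ.1) S ↔ v ∈ reach (cAdj Z₁ c (col₁ σ)) (hostSrc u Z a c σ S) :=
  ⟨fun h => reachCond_of_mem_reach Z₁ u Z a c σ S hS h,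
    fun h => mem_reach_of_reachCond Z₁ u Z a c σ S hS (w := Sum.inl v) h⟩

/-- **A zone vertex is reached** iff it is not the stray vertex and is reached inside its zone from the zone part
of `S`, or its junction is reached and it is connected to the anchor inside its zone. -/
theorem inr_mem_reach_iff (S : Set (V₁ ⊕ (Σ k, V k))) (hS : ∀ k, Sum.inr ⟨k, a k⟩ ∉ S) (k : ι) (x : V k) :
    Sum.inr ⟨k, x⟩ ∈ reach (cAdj (hang Z₁ u Z a) c σ.1) S ↔
      x ≠ a k ∧ (x ∈ reach (cAdj (Z k) c (st σ k).1) (rightSet S k) ∨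
        (u k ∈ reach (cAdj Z₁ c (col₁ σ)) (hostSrc u Z a c σ S) ∧ x ∈ reach (cAdj (Z k) c (st σ k).1) {a k})) :=
  ⟨fun h => reachCond_of_mem_reach Z₁ u Z a c σ S hS h,
    fun h => mem_reach_of_reachCond Z₁ u Z a c σ S hS (w := Sum.inr ⟨k, x⟩) h⟩

/-! ## The source `{inl a₁}` -/

/-- The stray vertices avoid a host singleton. -/
theorem stray_not_mem_singleton (a₁ : V₁) : ∀ k, Sum.inr ⟨k, a k⟩ ∉ ({Sum.inl a₁} : Set (V₁ ⊕ (Σ k, V k))) :=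
  fun _ h => by simp at h

/-- The host sources of `{inl a₁}` are `{a₁}`. -/
theorem hostSrc_singleton (a₁ : V₁) : hostSrc u Z a c σ {Sum.inl a₁} = {a₁} := by
  ext v
  simp only [hostSrc, leftSet, rightSet, Set.mem_union, Set.mem_setOf_eq, Set.mem_singleton_iff]
  constructor
  · rintro (h | ⟨k, rfl, hk⟩)
    · exact Sum.inl.inj h
    · exfalso
      obtain ⟨s, hs, -⟩ := hk
      simp at hs
  · rintro rfl
    exact Or.inl rfl

/-- A host vertex is reached from the anchor iff it is reached inside `Z₁`. -/
theorem inl_mem_reach_singleton_iff (a₁ : V₁) (v : V₁) :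
    Sum.inl v ∈ reach (cAdj (hang Z₁ u Z a) c σ.1) {Sum.inl a₁} ↔ v ∈ reach (cAdj Z₁ c (col₁ σ)) {a₁} := by
  rw [inl_mem_reach_iff Z₁ u Z a c σ _ (stray_not_mem_singleton a a₁), hostSrc_singleton]

/-- A zone vertex is reached from the anchor iff it is not the stray vertex, its exit is reached inside `Z₁` and
it is connected to the anchor of its zone. -/
theorem inr_mem_reach_singleton_iff (a₁ : V₁) (k : ι) (x : V k) :
    Sum.inr ⟨k, x⟩ ∈ reach (cAdj (hang Z₁ u Z a) c σ.1) {Sum.inl a₁} ↔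
      x ≠ a k ∧ (u k ∈ reach (cAdj Z₁ c (col₁ σ)) {a₁} ∧ x ∈ reach (cAdj (Z k) c (st σ k).1) {a k}) := by
  rw [inr_mem_reach_iff Z₁ u Z a c σ _ (stray_not_mem_singleton a a₁), hostSrc_singleton]
  have e : rightSet ({Sum.inl a₁} : Set (V₁ ⊕ (Σ k, V k))) k = ∅ := by
    ext x
    simp [rightSet]
  rw [e, reach_empty]
  simp only [Set.mem_empty_iff_false, false_or]

/-! ## Marks -/

/-- A mark set of the attachment at a host vertex: the junction of a zone whose anchor carries the mark. -/
theorem inl_mem_markSet_hang {T : ι → Type} (atk : (k : ι) → T k → V k) (m : (Σ k, T k) → Bool) (b : Bool)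
    (v : V₁) :
    Sum.inl v ∈ markSet (fun t : Σ k, T k => red u a t.1 (atk t.1 t.2)) m b ↔
      ∃ k, v = u k ∧ a k ∈ markSet (atk k) (fun t => m ⟨k, t⟩) b := by
  unfold markSet
  constructor
  · rintro ⟨⟨k, t⟩, ht, hm⟩
    obtain ⟨h1, h2⟩ := eq_of_red_eq_inl u a ht
    exact ⟨k, h2, t, h1, hm⟩
  · rintro ⟨k, rfl, t, ht, hm⟩
    exact ⟨⟨k, t⟩, by simp [ht, red_self], hm⟩

/-- A mark set of the attachment at a zone vertex: the zone's mark there, off the anchor. -/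
theorem inr_mem_markSet_hang {T : ι → Type} (atk : (k : ι) → T k → V k) (m : (Σ k, T k) → Bool) (b : Bool)
    (k : ι) (x : V k) :
    Sum.inr ⟨k, x⟩ ∈ markSet (fun t : Σ k, T k => red u a t.1 (atk t.1 t.2)) m b ↔
      x ≠ a k ∧ x ∈ markSet (atk k) (fun t => m ⟨k, t⟩) b := by
  unfold markSet
  constructor
  · rintro ⟨⟨l, t⟩, ht, hm⟩
    obtain ⟨h1, h2⟩ := eq_of_red_eq_inr u a ht
    obtain ⟨rfl, h3⟩ := Sigma.mk.inj_iff.1 h2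
    have h4 : atk l t = x := eq_of_heq h3
    rw [← h4]
    exact ⟨h1, t, rfl, hm⟩
  · rintro ⟨hx, t, ht, hm⟩
    exact ⟨⟨k, t⟩, by simp [ht, red_of_ne u a hx], hm⟩

/-- A stray vertex carries no mark. -/
theorem stray_not_mem_markSet_hang {T : ι → Type} (atk : (k : ι) → T k → V k) (m : (Σ k, T k) → Bool)
    (b : Bool) (k : ι) : Sum.inr ⟨k, a k⟩ ∉ markSet (fun t : Σ k, T k => red u a t.1 (atk t.1 t.2)) m b := by
  rw [inr_mem_markSet_hang]
  exact fun h => h.1 rfl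

/-- `Bl` at a host vertex. -/
theorem inl_mem_Bl_iff (v : V₁) :
    Sum.inl v ∈ (hang Z₁ u Z a).Bl σ ↔ ∃ k, v = u k ∧ a k ∈ (Z k).Bl (st σ k) :=
  inl_mem_markSet_hang u a (fun k => (Z k).at₁) σ.2.1 false v
/-- `Bl` at a zone vertex. -/
theorem inr_mem_Bl_iff (k : ι) (x : V k) :
    Sum.inr ⟨k, x⟩ ∈ (hang Z₁ u Z a).Bl σ ↔ x ≠ a k ∧ x ∈ (Z k).Bl (st σ k) :=
  inr_mem_markSet_hang u a (fun k => (Z k).at₁) σ.2.1 false k x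
/-- `Blt` at a host vertex. -/
theorem inl_mem_Blt_iff (v : V₁) :
    Sum.inl v ∈ (hang Z₁ u Z a).Blt σ ↔ ∃ k, v = u k ∧ a k ∈ (Z k).Blt (st σ k) :=
  inl_mem_markSet_hang u a (fun k => (Z k).at₁) σ.2.1 true v
/-- `Blt` at a zone vertex. -/
theorem inr_mem_Blt_iff (k : ι) (x : V k) :
    Sum.inr ⟨k, x⟩ ∈ (hang Z₁ u Z a).Blt σ ↔ x ≠ a k ∧ x ∈ (Z k).Blt (st σ k) :=
  inr_mem_markSet_hang u a (fun k => (Z k).at₁) σ.2.1 true k x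
/-- `M` at a host vertex. -/
theorem inl_mem_M_iff (v : V₁) :
    Sum.inl v ∈ (hang Z₁ u Z a).M σ ↔ ∃ k, v = u k ∧ a k ∈ (Z k).M (st σ k) :=
  inl_mem_markSet_hang u a (fun k => (Z k).at₂) σ.2.2 false v
/-- `M` at a zone vertex. -/
theorem inr_mem_M_iff (k : ι) (x : V k) :
    Sum.inr ⟨k, x⟩ ∈ (hang Z₁ u Z a).M σ ↔ x ≠ a k ∧ x ∈ (Z k).M (st σ k) :=
  inr_mem_markSet_hang u a (fun k => (Z k).at₂) σ.2.2 false k x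
/-- `Mt` at a host vertex. -/
theorem inl_mem_Mt_iff (v : V₁) :
    Sum.inl v ∈ (hang Z₁ u Z a).Mt σ ↔ ∃ k, v = u k ∧ a k ∈ (Z k).Mt (st σ k) :=
  inl_mem_markSet_hang u a (fun k => (Z k).at₂) σ.2.2 true v
/-- `Mt` at a zone vertex. -/
theorem inr_mem_Mt_iff (k : ι) (x : V k) :
    Sum.inr ⟨k, x⟩ ∈ (hang Z₁ u Z a).Mt σ ↔ x ≠ a k ∧ x ∈ (Z k).Mt (st σ k) :=
  inr_mem_markSet_hang u a (fun k => (Z k).at₂) σ.2.2 true k x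

end MultiExit

end ZoneZ

end PercRepro
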